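import Summits.Ventures.GridStability.Models.LossyNumericalRangeSpectrum

/-!
# GridStability/Models/PortHamiltonianSpectrum — linear port-Hamiltonian systems `ẋ = (J − R) Q x`: no eigenvalue in the open right half-plane (the small-signal shape of rung G3.b)

Cell `gridfusion` (LADDER-GRIDFUSION, APEX LINE rung G3.b «droop microgrid with Q–V voltage dynamics»; seat
gridfusion-model-3 (g6)). Generic linear algebra for the G3.b small-signal lane (MODEL-3-NOTES §1 (P13)):
the typed droop microgrid WITH voltage dynamics is a port-Hamiltonian system `ẋ = (J − R(x))∇H(x)`
(`Models/InverterNetworkHamiltonian.lean` → lit-2's `DroopMicrogridHamiltonian.lean`, [cite: ShinZavala2020,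
eqs. (11)–(13)]); at a rest point (`∇H(x*) = 0`) its Jacobian is `(J − R(x*))·∇²H(x*)`, so the small-signal
question is about matrices of the form `A = (J − R) Q` with `J` skew, `R ⪰ 0`, `Q = ∇²H(x*)` symmetric:
* `re_eig_nonpos_of_pH` ([folklore]): `Jᵀ = −J`, `R ⪰ 0`, `Q ≻ 0` ⇒ every complex eigenpair `A v = μ v`,
  `v ≠ 0`, has `Re μ ≤ 0` (at the eigenvector, with `u = Q v`: `μ·v*Qv = u*(J − R)u`, `Re u*Ju = 0`,
  `u*Ru ≥ 0`);
* `re_eig_neg_of_pH` ([folklore]): if moreover `R Q v ≠ 0` (the mode is DAMPED: it excites a dissipative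
  coordinate) then `Re μ < 0`.
So ONE exact PSD certificate `∇²H(x*) ≻ 0` (on the rotation complement; [cite: ShinZavala2020, Prop. 2]'s
hypothesis) excludes right-half-plane modes for ANY `n`, solver-free; a decay RATE then comes from the point
form `re_eig_gt_of_numRange_shift` (p510598). What is NOT here: the `3n × 3n` Fréchet derivative of
`DroopMicrogrid.field` and an instance (sized-ask item P13). THREE COLUMNS: linear algebra only; no model
data; no sentence says a converter or a microgrid is stable.
-/

noncomputable section

open Real Matrix Finset
open scoped ComplexOrder ComplexConjugate

namespace Summit.Ventures.GridStability.Models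

variable {ι : Type*} [Fintype ι] [DecidableEq ι]

omit [DecidableEq ι] in
/-- Adjoint step for a real SYMMETRIC `Q` and complex vectors: `v*·(Q w) = (Q v)*·w`. [folklore] -/
theorem star_dotProduct_map_mulVec_symm {Q : Matrix ι ι ℝ} (hQ : Qᵀ = Q) (v w : ι → ℂ) :
    star v ⬝ᵥ (Q.map ((↑) : ℝ → ℂ) *ᵥ w) = star (Q.map ((↑) : ℝ → ℂ) *ᵥ v) ⬝ᵥ w := by
  simp only [dotProduct, map_ofReal_mulVec_apply, Pi.star_apply, Finset.mul_sum, star_sum, star_mul',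
    Complex.star_def, Complex.conj_ofReal, Finset.sum_mul]
  rw [Finset.sum_comm]
  refine Finset.sum_congr rfl fun i _ => Finset.sum_congr rfl fun j _ => ?_
  have hij : Q j i = Q i j := congr_fun (congr_fun hQ i) j
  rw [hij]
  ring

omit [DecidableEq ι] in
/-- For a real SKEW matrix `J` (`Jᵀ = −J`) and a complex vector `u`: `Re(u*Ju) = 0`. [folklore] -/
theorem re_star_dotProduct_skew_eq_zero {J : Matrix ι ι ℝ} (hJ : Jᵀ = -J) (u : ι → ℂ) :
    (star u ⬝ᵥ (J.map ((↑) : ℝ → ℂ) *ᵥ u)).re = 0 := by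
  have h := star_dotProduct_transpose_map_mulVec J u
  rw [hJ, Matrix.map_neg _ (fun a => Complex.ofReal_neg a), Matrix.neg_mulVec, dotProduct_neg] at h
  -- h : -(u*Ju) = conj(u*Ju)
  have hre := congr_arg Complex.re h
  simp only [Complex.neg_re, Complex.conj_re] at hre
  linarith

/-- **Port-Hamiltonian linearisation: no mode in the open right half-plane.** `A = (J − R) Q` with `J`
real skew, `R ⪰ 0`, `Q ≻ 0` (all real) ⇒ every complex eigenpair `A v = μ v`, `v ≠ 0`, has `Re μ ≤ 0`.
[folklore] -/
theorem re_eig_nonpos_of_pH {J R Q : Matrix ι ι ℝ} (hJ : Jᵀ = -J) (hR : R.PosSemidef) (hQ : Q.PosDef)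
    {μ : ℂ} {v : ι → ℂ} (hv : v ≠ 0) (hAv : ((J - R) * Q).map ((↑) : ℝ → ℂ) *ᵥ v = μ • v) :
    μ.re ≤ 0 := by
  have hQs : Qᵀ = Q := by
    have h := hQ.isHermitian
    rw [Matrix.IsHermitian, Matrix.conjTranspose_eq_transpose_of_trivial] at h
    exact h
  set u : ι → ℂ := Q.map ((↑) : ℝ → ℂ) *ᵥ v with hudef
  set q : ℂ := star v ⬝ᵥ u with hqdef
  have hqpos : 0 < q := dotProduct_map_ofReal_mulVec_pos hQ hv
  obtain ⟨hqre, hqim⟩ := Complex.pos_iff.1 hqpos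
  -- μ q = u*(J − R)u
  have hmul : ((J - R) * Q).map ((↑) : ℝ → ℂ) *ᵥ v
      = (J - R).map ((↑) : ℝ → ℂ) *ᵥ u := by
    rw [hudef, Matrix.mulVec_mulVec]
    congr 1
    ext a b
    simp only [Matrix.map_apply, Matrix.mul_apply]
    push_cast
    rfl
  have hkey : μ * q = star u ⬝ᵥ ((J - R).map ((↑) : ℝ → ℂ) *ᵥ u) := by
    have h1 : star v ⬝ᵥ (Q.map ((↑) : ℝ → ℂ) *ᵥ (((J - R) * Q).map ((↑) : ℝ → ℂ) *ᵥ v)) = μ * q := by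
      rw [hAv, Matrix.mulVec_smul, dotProduct_smul, smul_eq_mul]
    rw [← h1, star_dotProduct_map_mulVec_symm hQs, ← hudef, hmul]
  have hsplit : (J - R).map ((↑) : ℝ → ℂ) = J.map ((↑) : ℝ → ℂ) - R.map ((↑) : ℝ → ℂ) := by
    ext a b; simp
  rw [hsplit, Matrix.sub_mulVec, dotProduct_sub] at hkey
  have hJ0 := re_star_dotProduct_skew_eq_zero hJ u
  have hR0 : 0 ≤ star u ⬝ᵥ (R.map ((↑) : ℝ → ℂ) *ᵥ u) := dotProduct_map_ofReal_mulVec_nonneg hR u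
  obtain ⟨hRre, -⟩ := Complex.nonneg_iff.1 hR0
  have hre := congr_arg Complex.re hkey
  have hq : q = (q.re : ℂ) := Complex.ext (by simp) (by simp [← hqim])
  rw [hq, Complex.sub_re, hJ0] at hre
  simp only [Complex.mul_re, Complex.ofReal_re, Complex.ofReal_im, mul_zero, sub_zero] at hre
  -- hre : μ.re * q.re = 0 − Re(u*Ru)
  nlinarith

/-- **Damped modes are strictly stable**: under the same hypotheses, if the mode excites a dissipative
coordinate (`R Q v ≠ 0`) then `Re μ < 0` (for `R ⪰ 0`, `u*Ru = 0` forces `R u = 0`). [folklore] -/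
theorem re_eig_neg_of_pH {J R Q : Matrix ι ι ℝ} (hJ : Jᵀ = -J) (hR : R.PosSemidef) (hQ : Q.PosDef)
    {μ : ℂ} {v : ι → ℂ} (hv : v ≠ 0) (hAv : ((J - R) * Q).map ((↑) : ℝ → ℂ) *ᵥ v = μ • v)
    (hRu : R.map ((↑) : ℝ → ℂ) *ᵥ (Q.map ((↑) : ℝ → ℂ) *ᵥ v) ≠ 0) : μ.re < 0 := by
  have hQs : Qᵀ = Q := by
    have h := hQ.isHermitian
    rw [Matrix.IsHermitian, Matrix.conjTranspose_eq_transpose_of_trivial] at h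
    exact h
  set u : ι → ℂ := Q.map ((↑) : ℝ → ℂ) *ᵥ v with hudef
  set q : ℂ := star v ⬝ᵥ u with hqdef
  have hqpos : 0 < q := dotProduct_map_ofReal_mulVec_pos hQ hv
  obtain ⟨hqre, hqim⟩ := Complex.pos_iff.1 hqpos
  have hmul : ((J - R) * Q).map ((↑) : ℝ → ℂ) *ᵥ v
      = (J - R).map ((↑) : ℝ → ℂ) *ᵥ u := by
    rw [hudef, Matrix.mulVec_mulVec]
    congr 1
    ext a b
    simp only [Matrix.map_apply, Matrix.mul_apply]
    push_cast
    rfl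
  have hkey : μ * q = star u ⬝ᵥ ((J - R).map ((↑) : ℝ → ℂ) *ᵥ u) := by
    have h1 : star v ⬝ᵥ (Q.map ((↑) : ℝ → ℂ) *ᵥ (((J - R) * Q).map ((↑) : ℝ → ℂ) *ᵥ v)) = μ * q := by
      rw [hAv, Matrix.mulVec_smul, dotProduct_smul, smul_eq_mul]
    rw [← h1, star_dotProduct_map_mulVec_symm hQs, ← hudef, hmul]
  have hsplit : (J - R).map ((↑) : ℝ → ℂ) = J.map ((↑) : ℝ → ℂ) - R.map ((↑) : ℝ → ℂ) := by
    ext a b; simp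
  rw [hsplit, Matrix.sub_mulVec, dotProduct_sub] at hkey
  have hJ0 := re_star_dotProduct_skew_eq_zero hJ u
  -- strict positivity of u*Ru: the complexified R is PSD and u ∉ ker
  have hRC : (R.map Complex.ofRealHom).PosSemidef := by
    open scoped MatrixOrder in
    obtain ⟨B, hB⟩ := CStarAlgebra.nonneg_iff_eq_star_mul_self.mp hR.nonneg
    rw [hB, Matrix.star_eq_conjTranspose, Matrix.map_mul,
      Matrix.conjTranspose_map _ (fun a => by simp)]
    exact Matrix.posSemidef_conjTranspose_mul_self _
  have hRpos : 0 < star u ⬝ᵥ (R.map ((↑) : ℝ → ℂ) *ᵥ u) := by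
    rcases (hRC.dotProduct_mulVec_nonneg u).lt_or_eq with h | h
    · exact h
    · exfalso
      apply hRu
      have := (hRC.dotProduct_mulVec_zero_iff u).1 h.symm
      exact this
  obtain ⟨hRre, -⟩ := Complex.pos_iff.1 hRpos
  have hre := congr_arg Complex.re hkey
  have hq : q = (q.re : ℂ) := Complex.ext (by simp) (by simp [← hqim])
  rw [hq, Complex.sub_re, hJ0] at hre
  simp only [Complex.mul_re, Complex.ofReal_re, Complex.ofReal_im, mul_zero, sub_zero] at hre
  nlinarith

end Summit.Ventures.GridStability.Models

end
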